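import Literature.Analysis.FluidPDE.LatticeShearWords
import HarnessLib

/-!
# K1 `ProjectedRenormalisationStep` (stmt-AnomalousDissipation-19071): the SHARED DEFINITIONS of the registered
# birth skeleton (helper; `--supports stmt-AnomalousDissipation-19071`)

Summits-side definitions file of route `SolenoidalFractalHomogenisation` (objects the K1 line posits; no theorems, no
named facts). It is the definitions block l.41–69 of the REGISTERED skeleton
`HOME/ad-ideate-p1/route/bc/ProjectedRenormalisationStep_birth-route.lean` (crux `ProjectedRenormalisationStep`, item
stmt-AnomalousDissipation-19071, skeleton sha `e2b567d2f478eabc…`, planner ad-ideate-p1 g4, stubs `stub_exists`,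
`stub_energy`, `stub_base`, `stub_cascade`, `stub_tail`) copied VERBATIM — same short names, same bodies, same binder
order, same `open`s — into the namespace `…Theorems.SolenoidalFractalHomogenisation.ProjectedRenormalisationStep`, so that
every K1 stub file imports this file, `open`s that namespace and carries the registered signature TEXTUALLY (the K1L
SHARED-DEFS RULE of `…Theorems.SolenoidalFractalHomogenisationLagrangianStepDefs`, applied to the Eulerian K1 skeleton).
Contents: `carrierUpTo` (levels `1..m` of a fractal shear carrier), `TruncSol` (weak A0 solutions of the renormalised
truncated problem `P_m(D)`: carrier `carrierUpTo D m`, viscosity `D.kbar m`), `FullSol` (weak A0 solutions of the full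
problem at index `j`), `Diss` (dissipation over `(0,1/2)` at viscosity `D.kbar m`).  The skeleton's `IsDatum` / `InClass`
are NOT re-declared: they are, token for token, `…Theorems.SolenoidalFractalHomogenisation.LagrangianStep.IsDatum` /
`….InClass` (`…LagrangianStepDefs`, `VF` = `UnitAddTorus (Fin 3) → EuclideanSpace ℝ (Fin 3)` reducibly), which the stub
files `open`.  The item is an ASIDE of the route (rev ≥ 5: superseded by K1R/K1L/K1L_D; its registered stubs `stub_exists`,
`stub_energy`, `stub_base` are generic A0 facts about fractal shear carriers).  This is NOT a proof of anything — in
particular not of anomalous dissipation; it only fixes the vocabulary of the K1 stubs.  Rung F-D1.A0 infrastructure.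
-/

set_option linter.dupNamespace false

namespace Summit.AnomalousDissipation.AnomalousDissipation.Theorems.SolenoidalFractalHomogenisation.ProjectedRenormalisationStep

open Literature.Analysis Literature.Analysis.FluidPDE Literature.Analysis.FunctionSpaces
open MeasureTheory Set Filter
open scoped ENNReal NNReal

noncomputable section

/-- The carrier truncated at level `m`: levels `1..m` of `D` (finite sum; `carrierUpTo D 0 = 0`).
[cite: ArmstrongVicol2025, §5.3 (PDF p. 65: the truncated problems of the cascade)] -/
def carrierUpTo {k : ℕ} (D : LatticeShear.FractalCarrierData k) (m : ℕ) (t : ℝ) (x : UnitAddTorus (Fin 3)) :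
    EuclideanSpace ℝ (Fin 3) :=
  ∑ i ∈ Finset.range m, D.level (i + 1) t x

/-- Weak solutions on `[0,1)` of the RENORMALISED TRUNCATED problem `P_m(D)`: passive solenoidal vector (`A = 0`) along
`carrierUpTo D m` at the bookkept viscosity `D.kbar m`. [cite: ArmstrongVicol2025, §5.3 (PDF p. 65: renormalised truncated problems)] -/
def TruncSol {k : ℕ} (D : LatticeShear.FractalCarrierData k) (m : ℕ)
    (w₀ : UnitAddTorus (Fin 3) → EuclideanSpace ℝ (Fin 3)) (u : ℝ → UnitAddTorus (Fin 3) → EuclideanSpace ℝ (Fin 3)) : Prop :=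
  Torus.IsWeakPassiveVectorOn 0 1 (D.kbar m) (carrierUpTo D m) w₀ u

/-- Weak solutions on `[0,1)` of the FULL problem at index `j`: carrier `D.carrier`, viscosity `ν_j = D.kbar j`.
[cite: ArmstrongVicol2025, Thm. 1.1 (the physical problem along the tuned viscosities)] -/
def FullSol {k : ℕ} (D : LatticeShear.FractalCarrierData k) (j : ℕ)
    (w₀ : UnitAddTorus (Fin 3) → EuclideanSpace ℝ (Fin 3)) (w : ℝ → UnitAddTorus (Fin 3) → EuclideanSpace ℝ (Fin 3)) : Prop :=
  Torus.IsWeakPassiveVectorOn 0 1 (D.kbar j) D.carrier w₀ w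

/-- Dissipation over `(0, 1/2)` at viscosity `D.kbar m` (extended-real valued, no junk value). [folklore] -/
def Diss {k : ℕ} (D : LatticeShear.FractalCarrierData k) (m : ℕ) (u : ℝ → UnitAddTorus (Fin 3) → EuclideanSpace ℝ (Fin 3)) : ℝ≥0∞ :=
  Torus.eVectorDissipation (D.kbar m) u 0 (1 / 2)

end

end Summit.AnomalousDissipation.AnomalousDissipation.Theorems.SolenoidalFractalHomogenisation.ProjectedRenormalisationStep
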